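/-
Copyright: statement-level skeleton of a published paper (lit-balaban cell, Phase-2 proof seat p19, gen 4). No claims beyond
what the kernel checks below.
-/
import Mathlib
import Literature.MathematicalPhysics.QuantumFieldTheory.Balaban1983to89.B3AmpIBPBounds

/-!
# B3 — T. Bałaban, *(Higgs)₂,₃ quantum fields in a finite volume. III. Renormalization*, CMP **88** (1983) 411–445
[Balaban1983Higgs3] — Proposition 2.1 p. 424 WITH THE (2.4) EXCEPTION: the FAMILY of multi-graph expansions of the IBP-ready
amplitudes over the connected count data (r15's carrier `B3Prop1.GraphExpansion`, `Is24 :=` "the block is a (2.4)-block"), its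
non-vacuity, and the vacuity of the earlier `B3Prop21Uniform` family

statement-level skeleton of published theorems with citation tags; proofs where landed; nothing here is a claim about
the Yang–Mills mass gap

PDF held: `paper:balaban1983-higgs-2-3-quantum-fields-finite-volume` (journal page = PDF page + 410).

Part of the Phase-2 work on SKELETON rows **B3.Prop2.1 / B3.Prop2.2** (unit `lit-balaban-p19` gen 4, HOME
`run/shared/lean/pub/lit-balaban/`): the (2.4) EXCEPTION of Proposition 2.1 (`B3LatticeIBP` → `B3AmpIBP` → `B3AmpIBPClosed` →
`B3AmpIBPAll` → `B3IBPSites` → `B3IBPDegrees`, `B3IBPKernelBounds` → `B3AmpIBPBounds` → this file and `B3Prop21Except24Ordering`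
→ `B3Prop21Except24`, which proves `prop21_except24 : B3Prop1.Prop21 (famIBP P mbar)` for the family defined here).

WHAT IS REPRODUCED.  Proposition 2.1 p. 424 [PDF 14], verbatim: *"Let G be a connected graph such that its each connected
subgraph, with the possible exception of the subgraphs (2.4), has a positive degree. Then we define G_ren = {G} and
Proposition 1 holds in this case."*  KERNEL-CHECKED HERE: the FAMILY `famIBP P mbar n̄ D := expansionIBP P (mbar n̄) D` of
r15's carrier — graphs = all CONNECTED count data on the vertex sets `Fin n` with at most `mb` lines and the lattice constants
of `P` (`CGraphC`); analytic datum `D : DatumIBP P` = `k`, the running couplings, and for every such graph AND localization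
`{□(v)}` an IBP-ready amplitude (`B3AmpIBPBounds.IBPAmp`, constants `≤ Cmax`, `cD ≤ CD`); `E(G, {□(v)}, Φ, A)` = its total
amplitude `Amp.Etot`; connected subgraphs = the components of the `G_i` along every ordering (`B3Prop21Instance.Component`) with
their degrees `degQ`, and **`Is24 G ⟨l̃, i, b⟩ := Is24Block (G along l̃) i b`** (`B3IBPSites.Is24Block`: the component is a
single line of (2.4)-shape of degree `0`); the printed hypothesis `PosSubgraphsExcept24` read back on the orderings
(`hyp_of_posSubgraphsExcept24`).  NON-VACUITY: `DatumIBP.zero` / `datumIBP_nonempty` (the zero amplitudes are IBP-ready).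
CORRECTION recorded as a theorem: `datum_isEmpty` — the index type `B3Prop21Uniform.Datum P` of the earlier uniform family is
EMPTY (it demands a connected amplitude for EVERY count datum, including the disconnected ones), so
`B3Prop21Uniform.prop21_uniform` holds vacuously; the present family, indexed over connected graphs, is the corrected one.
HONEST SCOPE: the analytic inputs ((2.5), (2.10)–(2.12), their derivative budget, the IBP-readiness `K_l = ∂⁺K♭_l`, the
face-vanishing smooth localization) are hypotheses (fields) of the class `IBPAmp`, not derived from Propositions I.2.1/I.2.3.
-/

open Finset

namespace Literature.MathematicalPhysics.QuantumFieldTheory.Balaban1983to89.B3Ineq213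

open B3Ineq215 B3Sect2FirstEstimate B3Prop1

variable {V : Type} [Fintype V] [DecidableEq V] {m : ℕ}

/-! ## The earlier uniform family is vacuously indexed -/

/-- **Correction to `B3Prop21Uniform`**: its index type `Datum P` demands an amplitude of the class `Amp` — whose field `conn`
says the lines connect the vertices — for EVERY count datum, including the disconnected ones (e.g. two loops on two vertices);
hence `Datum P` is EMPTY and `B3Prop21Uniform.prop21_uniform` / `prop22_uniform` hold vacuously.  The corrected statement is
`prop21_except24` below (amplitudes indexed over the CONNECTED graphs `CGraphC`, datum type inhabited: `datumIBP_nonempty`).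
[cite: Balaban1983Higgs3, Prop. 2.1 p.424] -/
theorem datum_isEmpty (P : Params) : IsEmpty (Datum P) := by
  refine ⟨fun D => ?_⟩
  -- the disconnected count datum: two loops on two vertices
  let G : Counts (Fin 2) 2 :=
    { src := fun i => i
      tgt := fun i => i
      touches := fun v => ⟨v, Or.inl rfl⟩
      diffOn := fun _ _ => 0
      vecLegAvg := fun _ _ => 0
      etaPow := fun _ => 0
      d := P.d
      L := P.L
      δ₁ := P.δ₁
      d_pos := P.d_pos
      two_le_L := P.two_le_L
      δ₁_pos := P.δ₁_pos }
  have hconn : LinesConnect G.src G.tgt := (D.amp G).conn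
  have hEq : ∀ a b : Fin 2, Relation.EqvGen (fun a b => ∃ l, G.src l = a ∧ G.tgt l = b) a b → a = b := by
    intro a b h
    induction h with
    | rel x y hxy =>
      obtain ⟨l, h1, h2⟩ := hxy
      exact h1.symm.trans h2
    | refl => rfl
    | symm _ _ _ ih => exact ih.symm
    | trans _ _ _ _ _ ih1 ih2 => exact ih1.trans ih2
  exact absurd (hEq 0 1 (hconn 0 1)) (by decide)

/-! ## The multi-graph expansion of IBP-ready amplitudes and Proposition 2.1 with the (2.4) exception -/

/-- The constants of the family: those of `B3Prop21Uniform.Params` and the bound `CD` on the constants `cD` of the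
differentiated vertex bounds. [cite: Balaban1983Higgs3, Prop. 1 p.421] -/
structure ParamsIBP extends Params where
  /-- bound on the constants of the differentiated vertex bounds -/
  CD : ℝ

/-- The graphs of the expansion at the size bound `mb`: the CONNECTED count data on the vertex sets `Fin n` with `m ≤ mb` lines
and the lattice constants of `P` (Proposition 2.1: *"Let G be a connected graph"*). [cite: Balaban1983Higgs3, Prop. 2.1 p.424] -/
structure CGraphC (P : Params) (mb : ℕ) extends CGraph P mb where
  /-- the lines connect the vertex set -/
  conn : LinesConnect G.src G.tgt

/-- The analytic datum of one expansion: the number `k` of completed steps, the running couplings, and for every count datum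
AND localization `{□(v)}` the IBP-ready localized lattice graph amplitude at these values (vertex functions with their
localizations, kernels, constants `≤ Cmax`, `cD ≤ CD`; the orders do not depend on the localization).
[cite: Balaban1983Higgs3, Prop. 1 p.421] -/
structure DatumIBP (P : ParamsIBP) where
  /-- number of completed renormalization steps -/
  k : ℕ
  /-- `e(L^kε)` -/
  eRun : ℝ
  /-- `λ(L^kε)` -/
  lamRun : ℝ
  eRun_pos : 0 < eRun
  lamRun_pos : 0 < lamRun
  /-- the amplitude of each connected graph at each localization -/
  amp : ∀ {n m : ℕ} (G : Counts (Fin n) m), LinesConnect G.src G.tgt → (Fin n → Fin G.toModel.d → ℕ) → IBPAmp G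
  amp_k : ∀ {n m : ℕ} (G : Counts (Fin n) m) (hG : LinesConnect G.src G.tgt) (box : Fin n → Fin G.toModel.d → ℕ),
    (amp G hG box).k = k
  amp_box : ∀ {n m : ℕ} (G : Counts (Fin n) m) (hG : LinesConnect G.src G.tgt) (box : Fin n → Fin G.toModel.d → ℕ),
    (amp G hG box).box = box
  amp_eRun : ∀ {n m : ℕ} (G : Counts (Fin n) m) (hG : LinesConnect G.src G.tgt) (box : Fin n → Fin G.toModel.d → ℕ),
    (amp G hG box).eRun = eRun
  amp_lamRun : ∀ {n m : ℕ} (G : Counts (Fin n) m) (hG : LinesConnect G.src G.tgt) (box : Fin n → Fin G.toModel.d → ℕ),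
    (amp G hG box).lamRun = lamRun
  /-- the orders do not depend on the localization -/
  amp_dv : ∀ {n m : ℕ} (G : Counts (Fin n) m) (hG : LinesConnect G.src G.tgt) (box box' : Fin n → Fin G.toModel.d → ℕ),
    (amp G hG box).dv = (amp G hG box').dv
  amp_ds : ∀ {n m : ℕ} (G : Counts (Fin n) m) (hG : LinesConnect G.src G.tgt) (box box' : Fin n → Fin G.toModel.d → ℕ),
    (amp G hG box).ds = (amp G hG box').ds
  /-- the constants O(1) of (2.10)–(2.12) are bounded by `Cmax` -/
  amp_C_le : ∀ {n m : ℕ} (G : Counts (Fin n) m) (hG : LinesConnect G.src G.tgt) (box : Fin n → Fin G.toModel.d → ℕ)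
    (l : Fin m), (amp G hG box).C l ≤ P.Cmax
  /-- the constants of the differentiated vertex bounds are bounded by `CD` -/
  amp_cD_le : ∀ {n m : ℕ} (G : Counts (Fin n) m) (hG : LinesConnect G.src G.tgt) (box : Fin n → Fin G.toModel.d → ℕ),
    (amp G hG box).cD ≤ P.CD

/-- The reference localization used to read off the (localization-independent) orders. [cite: Balaban1983Higgs3, (1.33) p.420] -/
def box₀ {n dd : ℕ} : Fin n → Fin dd → ℕ := fun _ _ => 0

/-- **The multi-graph expansion of r15's carrier for the IBP-ready amplitudes** (datum `D`, size bound `mb`): classes = graphs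
= `CGraphC P.toParams mb`; `E({G}, {□(v)}, ·, ·)` = the total amplitude of the datum's amplitude of `G` at `{□(v)}`; `d({□(v)})`
= `boxTreeLen`; norms `Π_v N^Φ_v`, `Π_v N^A_v`; orders `Σ_v d_v(v)`, `Σ_v d_s(v)`; connected subgraphs = the components of the
`G_i` along every ordering with degrees `degQ`; **`Is24` := the component is a (2.4)-block** (`Is24Block`).
[cite: Balaban1983Higgs3, Prop. 2.1 p.424] -/
noncomputable def expansionIBP (P : ParamsIBP) (mb : ℕ) (D : DatumIBP P) : GraphExpansion where
  eRun := D.eRun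
  lamRun := D.lamRun
  eRun_pos := D.eRun_pos
  lamRun_pos := D.lamRun_pos
  RenClass := CGraphC P.toParams mb
  Loc := fun G => Fin G.n → Fin G.G.toModel.d → ℕ
  ExtS := Unit
  ExtV := Unit
  E := fun G box _ _ => (D.amp G.G G.conn box).toAmp.Etot
  ds := fun G => ∑ v, (D.amp G.G G.conn box₀).ds v
  dv := fun G => ∑ v, (D.amp G.G G.conn box₀).dv v
  treeLen := fun G box => boxTreeLen G.G.L D.k box
  treeLen_nonneg := fun G box => boxTreeLen_nonneg G.G.L D.k box
  normS := fun _ G box _ => ∏ v, (D.amp G.G G.conn box).NPhi v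
  normV := fun _ G box _ => ∏ v, (D.amp G.G G.conn box).NA v
  normS_nonneg := fun _ G box _ => prod_nonneg fun v _ => (D.amp G.G G.conn box).NPhi_nonneg v
  normV_nonneg := fun _ G box _ => prod_nonneg fun v _ => (D.amp G.G G.conn box).NA_nonneg v
  Graph := CGraphC P.toParams mb
  single := id
  Connected := fun _ => True
  Sub := fun G => Component G.G
  subDeg := fun G H => degQ (relabelCounts G.G H.1) H.2.1 H.2.2.1
  Is24 := fun G H => Is24Block (relabelCounts G.G H.1) H.2.1 H.2.2.1

/-- The family `fam n̄ D` of r15's `Prop21`: at level `n̄` the graphs have at most `mbar n̄` lines. [cite: Balaban1983Higgs3, Prop. 2.1 p.424] -/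
noncomputable def famIBP (P : ParamsIBP) (mbar : ℕ → ℕ) : ℕ → DatumIBP P → GraphExpansion :=
  fun nbar D => expansionIBP P (mbar nbar) D

/-- The printed hypothesis, read on the expansion: every component of every `G_i` along every ordering is a (2.4)-block or
has positive (ℝ-valued) degree. [cite: Balaban1983Higgs3, Prop. 2.1 p.424] -/
theorem hyp_of_posSubgraphsExcept24 {P : ParamsIBP} {mb : ℕ} {D : DatumIBP P} {G : CGraphC P.toParams mb}
    (h : PosSubgraphsExcept24 (expansionIBP P mb D) G) (σ : Equiv.Perm (Fin G.m)) :
    ∀ i, i ≤ G.m → ∀ b ∈ (relabelCounts G.G σ).toModel.reps i, (relabelCounts G.G σ).toModel.Nontriv i b →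
      Is24Block (relabelCounts G.G σ) i b ∨ 0 < (relabelCounts G.G σ).toModel.D i b := by
  intro i hi b hb hn
  have h' := h.2 ⟨σ, ⟨i, Nat.lt_succ_of_le hi⟩, ⟨b, hb, hn⟩⟩
  rcases h' with h24 | hpos
  · exact Or.inl h24
  · right
    have hc := cast_degQ (relabelCounts G.G σ) i b
    have : (0 : ℝ) < ((degQ (relabelCounts G.G σ) i b : ℚ) : ℝ) := by exact_mod_cast hpos
    rw [hc] at this
    exact this

/-! ## Non-vacuity: the index type is inhabited -/

/-- The zero amplitude over a connected count datum is IBP-ready (all vertex functions and kernels `0`, constants `0`, `cD = 1`).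
[cite: Balaban1983Higgs3, Prop. 2.1 p.424] -/
noncomputable def IBPAmp.zero {n m : ℕ} (G : Counts (Fin n) m) (hG : LinesConnect G.src G.tgt) (k : ℕ)
    (box : Fin n → Fin G.toModel.d → ℕ) : IBPAmp G where
  k := k
  box := box
  u := fun _ _ => 0
  K := fun _ _ _ _ => 0
  C := fun _ => 0
  eRun := 1
  lamRun := 1
  dv := fun _ => 0
  ds := fun _ => 0
  NPhi := fun _ => 0
  NA := fun _ => 0
  C_nonneg := fun _ => le_rfl
  eRun_nonneg := zero_le_one
  lamRun_nonneg := zero_le_one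
  NPhi_nonneg := fun _ => le_rfl
  NA_nonneg := fun _ => le_rfl
  e_nonneg := fun v => Nat.cast_nonneg _
  conn := hG
  u_le := fun v x => by simp
  K_le := fun l t _ x y => by simp
  dir := fun _ => ⟨0, G.d_pos⟩
  Kb := fun _ _ _ _ => 0
  cD := 1
  one_le_cD := le_rfl
  K_eq := fun l _ _ t x y => by simp [fdiffQ]
  Kb_le := fun l _ _ t _ x y => by simp
  u_face := fun l _ _ x _ => rfl
  du_le := fun l _ _ x => by simp [bdiffQ]
  KdX_le := fun l μ t _ x y => by simp [dK, shK]
  KdY_le := fun l ν t _ x y => by simp [dK, shK]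
  KdXY_le := fun l μ ν t _ x y => by simp [dK, shK]

/-- **A datum exists** (for `Cmax ≥ 0`, `CD ≥ 1`): the zero amplitudes — the family `famIBP` is NOT vacuously indexed.
[cite: Balaban1983Higgs3, Prop. 2.1 p.424] -/
noncomputable def DatumIBP.zero (P : ParamsIBP) (hC : 0 ≤ P.Cmax) (hD : 1 ≤ P.CD) : DatumIBP P where
  k := 0
  eRun := 1
  lamRun := 1
  eRun_pos := one_pos
  lamRun_pos := one_pos
  amp := fun G hG box => IBPAmp.zero G hG 0 box
  amp_k := fun _ _ _ => rfl
  amp_box := fun _ _ _ => rfl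
  amp_eRun := fun _ _ _ => rfl
  amp_lamRun := fun _ _ _ => rfl
  amp_dv := fun _ _ _ _ => rfl
  amp_ds := fun _ _ _ _ => rfl
  amp_C_le := fun _ _ _ _ => hC
  amp_cD_le := fun _ _ _ => hD

/-- The datum type is inhabited. [cite: Balaban1983Higgs3, Prop. 2.1 p.424] -/
theorem datumIBP_nonempty (P : ParamsIBP) (hC : 0 ≤ P.Cmax) (hD : 1 ≤ P.CD) : Nonempty (DatumIBP P) :=
  ⟨DatumIBP.zero P hC hD⟩

end Literature.MathematicalPhysics.QuantumFieldTheory.Balaban1983to89.B3Ineq213
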